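import Summits.FinalStateConjecture.FinalStateConjecture.Theorems.PhotonSphereChannelsChannelsResolveTameDevelopmentsRSchwarzschildClockMetric
import Summits.FinalStateConjecture.FinalStateConjecture.Theorems.PhotonSphereChannelsChannelsResolveTameDevelopmentsRSchwarzschildTameFrame
import Summits.FinalStateConjecture.FinalStateConjecture.Theorems.PhotonSphereChannelsChannelsResolveTameDevelopmentsRSchwarzschildBallChart
import Summits.FinalStateConjecture.FinalStateConjecture.Theorems.PhotonSphereChannelsTameHullDefs
import Summits.FinalStateConjecture.FinalStateConjecture.Theorems.EIHFluxBalanceModulatedKerrHandoffBentLabDeviationAux4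
import Literature.Geometry.Lorentzian.BilinPullbackEstimates
import HarnessLib

/-!
# Route PhotonSphereChannels · crux `ChannelsResolveTameDevelopmentsR` (K2R-T2, stmt-FinalStateConjecture-17430) —
# the SCHWARZSCHILD END, IV-f: the clock-adapted centred TAME BALLS (the `tame` clause of `EndDatum.IsTameEnd`) for
# the horizon-penetrating Schwarzschild patch with the Painlevé–Gullstrand-corrected clock

For an end datum `E` of `Kerr.spacetime M 0 r₁` (`0 < r₁ < 2M`) whose clock is `t* + F(r)` with the profile of file
IV-a (`F' = ψ`: PG rate on `[r₁/2, R_a]`, `R_a ≥ 8M`, zero beyond `R_b`) and whose d.o.c. is `{r > 2M}`, there are ONE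
`Λ` and ONE `r₀ > 0` such that every point `q` of the d.o.c. is the centre of a clock-adapted tame ball: the chart
`Ψ(y) = q + A_q y + (F(r_q) − F(r)) ∂_{t*}` of file IV-d with the frame `A_q` of file IV-c is a late-time chart of the
patch over `B(0, r₀)`, centred at `q`, reading the clock as `x⁰ + clock(q)`, with

* deviation `Ψ^* g − η = bilinPullback (q + A_q ·) G − η` (`G` the clock-coordinate field of file IV-e), hence
  `‖Dᵐ(Ψ^* g − η)‖ ≤ 4³ 3! 3⁵ N + ‖η‖` on the ball (`Schw.norm_iteratedFDeriv_bilinPullback_le` with `‖A_q‖ ≤ 3` and the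
  global bounds `N` on `Dʲ G`) — the `C³` clause with `Λ` independent of `q`;
* `‖Ψ^* g − η‖ ≤ 27 |C₁| r₀ + κ/(1 + κ) ≤ 1/4 + 1/4` pointwise (Lipschitz bound on `G` for the variation over the ball;
  at the centre the EXACT pull-back identity of file IV-c, with `κ = 0` in the PG zone `r_q ≤ R_a` and
  `κ ≤ 2M/r_q < 1/4` beyond) — the `C⁰` clause;
* `Ψ_* ∂₀` future-directed causal (its length² is `(Ψ^*g)(∂₀, ∂₀) = −1 + O(1/2)`, its `t*`-component is
  `1 + ψ λ ⟪x̂, n⟫ > 0`).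

`Schw.exists_tame_balls` is the statement. Everything proved; no definitions.
References: M. T. Anderson (2004), Def. 1.1 [Anderson2004]; K. Martel, E. Poisson, Am. J. Phys. 69 (2001) 476, §II
[MartelPoisson2001].
-/

noncomputable section
set_option maxSynthPendingDepth 3 -- nested operator types `E4 →L E4 →L E4 →L ℝ` (as in the tree files)
set_option linter.dupNamespace false -- `Summit.FinalStateConjecture.FinalStateConjecture.…` is the tree's layout

open TopologicalSpace Filter Topology Set Function Metric
open scoped ContDiff Topology InnerProductSpace Manifold ENNReal NNReal Nat

namespace Summit.FinalStateConjecture.FinalStateConjecture.Theorems.TameHull.Schw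

open Literature.Geometry.Lorentzian Schwarzschild
open Summit.FinalStateConjecture.FinalStateConjecture.Theorems.SeamedChartsExhaust.Negative

/-! ### Two operator-norm facts -/

/-- `‖dt* ⊗ dt*‖ ≤ 1` (`|u⁰ w⁰| ≤ ‖u‖‖w‖`). [folklore] -/
theorem norm_tmul_dx_zero_le : ‖(E4.tmul (E4.dx 0) (E4.dx 0) : E4 →L[ℝ] E4 →L[ℝ] ℝ)‖ ≤ 1 := by
  refine ContinuousLinearMap.opNorm_le_bound₂ _ zero_le_one fun u w ↦ ?_
  rw [E4.tmul_apply, one_mul, Real.norm_eq_abs, abs_mul]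
  have hu := (norm_sq_eq_time_sq_add u).2.1
  have hw := (norm_sq_eq_time_sq_add w).2.1
  exact mul_le_mul hu hw (abs_nonneg _) (norm_nonneg _)

/-- Derivatives of an affine map `z ↦ q + A z`: `‖Dⁱ‖ ≤ ‖A‖` for `i ≥ 1` (`D¹ = A`, `Dⁱ = 0` for `i ≥ 2`). [folklore] -/
theorem norm_iteratedFDeriv_affine_le (q : E4) (A : E4 →L[ℝ] E4) {i : ℕ} (hi : 1 ≤ i) (x : E4) :
    ‖iteratedFDeriv ℝ i (fun z ↦ q + A z) x‖ ≤ ‖A‖ := by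
  have hf : fderiv ℝ (fun z ↦ q + A z) = fun _ ↦ A :=
    funext fun z ↦ ((A.hasFDerivAt (x := z)).const_add q).fderiv
  obtain ⟨j, rfl⟩ := Nat.exists_eq_add_of_le hi
  rw [add_comm, ← norm_iteratedFDeriv_fderiv, hf]
  rcases j with _ | j
  · rw [norm_iteratedFDeriv_zero]
  · rw [iteratedFDeriv_const_of_ne (Nat.succ_ne_zero j)]
    simp

/-- Coefficient bookkeeping at the centre (the `r`-factors of `σ = r ⟪n, ·⟫` cancel). [folklore] -/
theorem centre_coeff_identities (M r p a₀ b₀ α β : ℝ) (hr : r ≠ 0) :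
    (2 * M / r + p * (1 - 2 * M / r)) / r * (a₀ * (r * β) + r * α * b₀) =
        (2 * M / r + p * (1 - 2 * M / r)) * (a₀ * β + α * b₀) ∧
      (2 * M / r * (1 - p) ^ 2 - p ^ 2) / r ^ 2 * (r * α * (r * β)) =
        (2 * M / r * (1 - p) ^ 2 - p ^ 2) * (α * β) := by
  constructor <;> field_simp

/-! ### The tame balls -/

section Patch

variable [Kerr.Facts] {M r₁ : ℝ} {hM : 0 ≤ M}

-- one long assembly proof (chart, frame, deviation identity, `C³`/`C⁰` bounds, orientation, clock): the default
-- per-declaration heartbeat budget is too small for it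
set_option maxHeartbeats 1600000 in
/-- **The `tame` clause of `IsTameEnd` for the Schwarzschild end with the Painlevé–Gullstrand-corrected clock.**
See the module docstring. [cite: Anderson2004, Def. 1.1] -/
theorem exists_tame_balls (E : EndDatum (Kerr.spacetime M 0 r₁ hM)) (hM' : 0 < M) (hr₁ : 0 < r₁) (hr₂ : r₁ < 2 * M) {F ψ : ℝ → ℝ} (hF : ContDiff ℝ ∞ F) (hψ : ContDiff ℝ ∞ ψ) (hFψ : ∀ r, HasDerivAt F (ψ r) r) {Ra Rb : ℝ} (hRa : 8 * M ≤ Ra) (hab : Ra < Rb) (hψPG : ∀ r, r₁ / 2 ≤ r → r ≤ Ra → ψ r = √(2 * M / r) / (1 + √(2 * M / r))) (hψ0 : ∀ r, Rb ≤ r → ψ r = 0) (hψb : ∀ r, 0 < r → 0 ≤ ψ r ∧ ψ r ≤ √(2 * M / r) / (1 + √(2 * M / r))) (hclock : ∀ x, E.clock x = x.1 0 + F (Kerr.radius 0 x.1)) (hdoc : E.doc = {x | 2 * M < Kerr.radius 0 x.1}) : ∃ (Λ : ℝ≥0) (r₀ : ℝ), 0 < r₀ ∧ ∀ q ∈ E.doc,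 let U : Opens E4 := ⟨Metric.ball (0 : E4) r₀, Metric.isOpen_ball⟩; ∃ Ψ : U → (Kerr.spacetime M 0 r₁ hM).carrier, (Kerr.spacetime M 0 r₁ hM).IsLateChart (Minkowski.backgroundOn U) Set.univ (-r₀) Ψ ∧ (∃ x : U, (x : E4) = 0 ∧ Ψ x = q) ∧ supCkENorm (U : Set E4) 3 ((Kerr.spacetime M 0 r₁ hM).deviationExtend (Minkowski.backgroundOn U) Ψ) ≤ (Λ : ℝ≥0∞) ∧ supCkENorm (U : Set E4) 0 ((Kerr.spacetime M 0 r₁ hM).deviationExtend (Minkowski.backgroundOn U) Ψ) ≤ 1 / 2 ∧ (∀ x : U, (Kerr.spacetime M 0 r₁ hM).timeOrientation.IsFutureDirected (mfderiv 𝓘(ℝ, E4) (𝓡 4) Ψ x (E4.basisVector 0))) ∧ ∀ x : U, E.clock (Ψ x) = (x : E4) 0 + E.clock q := by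
  /- (A) the clock-coordinate field and its global bounds -/
  have hRb : r₁ / 2 < Rb := by linarith
  obtain ⟨G, hGs, -, -, hGmid, hGbd⟩ := exists_clockMetric M r₁ Rb hr₁ hRb hψ hψ0
  obtain ⟨C₀, hC₀⟩ := hGbd 0
  obtain ⟨C₁, hC₁⟩ := hGbd 1
  obtain ⟨C₂, hC₂⟩ := hGbd 2
  obtain ⟨C₃, hC₃⟩ := hGbd 3
  obtain ⟨N, hN⟩ : ∃ N : ℝ, N = max (max |C₀| |C₁|) (max |C₂| |C₃|) := ⟨_, rfl⟩
  have hN0 : 0 ≤ N := by rw [hN]; exact le_max_of_le_left (le_max_of_le_left (abs_nonneg _))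
  have hNb : ∀ j, j ≤ 3 → ∀ x, ‖iteratedFDeriv ℝ j G x‖ ≤ N := by
    intro j hj x
    rw [hN]
    interval_cases j
    · exact ((hC₀ x).trans (le_abs_self _)).trans (le_max_of_le_left (le_max_left _ _))
    · exact ((hC₁ x).trans (le_abs_self _)).trans (le_max_of_le_left (le_max_right _ _))
    · exact ((hC₂ x).trans (le_abs_self _)).trans (le_max_of_le_right (le_max_left _ _))
    · exact ((hC₃ x).trans (le_abs_self _)).trans (le_max_of_le_right (le_max_right _ _))
  -- Lipschitz bound on `G`
  have hGlip : ∀ x y : E4, ‖G y - G x‖ ≤ |C₁| * ‖y - x‖ := fun x y ↦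
    convex_univ.norm_image_sub_le_of_norm_fderiv_le (fun z _ ↦ hGs.differentiable (by simp) z)
      (fun z _ ↦ by rw [← norm_iteratedFDeriv_one]; exact (hC₁ z).trans (le_abs_self _)) (mem_univ x) (mem_univ y)
  /- (B) the constants -/
  obtain ⟨r₀, hr₀def⟩ : ∃ r₀ : ℝ, r₀ = min ((2 * M - r₁) / 4) (1 / (108 * |C₁| + 4)) := ⟨_, rfl⟩
  have hr₀pos : 0 < r₀ := by rw [hr₀def]; exact lt_min (by linarith) (by positivity)
  have hr₀a : r₀ ≤ (2 * M - r₁) / 4 := by rw [hr₀def]; exact min_le_left _ _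
  have hr₀b : 27 * |C₁| * r₀ ≤ 1 / 4 := by
    have h1 : r₀ ≤ 1 / (108 * |C₁| + 4) := by rw [hr₀def]; exact min_le_right _ _
    have h2 : r₀ * (108 * |C₁| + 4) ≤ 1 := by rwa [le_div_iff₀ (by positivity)] at h1
    nlinarith [abs_nonneg C₁, hr₀pos]
  obtain ⟨Λr, hΛr⟩ : ∃ Λr : ℝ, Λr = 4 ^ 3 * (3 ! : ℝ) * 3 ^ (3 + 2) * N +
      ‖(Minkowski.bilin : E4 →L[ℝ] E4 →L[ℝ] ℝ)‖ := ⟨_, rfl⟩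
  have hΛr0 : 0 ≤ Λr := by rw [hΛr]; positivity
  refine ⟨Real.toNNReal Λr, r₀, hr₀pos, fun q hq ↦ ?_⟩
  intro U
  /- (C) the centre, the clock rate there, the frame -/
  rw [hdoc] at hq
  obtain ⟨r, hrdef⟩ : ∃ r : ℝ, r = E4.spatialNorm q.1 := ⟨_, rfl⟩
  have hqr : 2 * M < r := by rw [hrdef, ← Kerr.radius_zero_left q.1]; exact hq
  have hr0 : 0 < r := by linarith
  obtain ⟨S, hSdef⟩ : ∃ S : ℝ, S = 2 * M / r := ⟨_, rfl⟩
  have hS0 : 0 ≤ S := by rw [hSdef]; positivity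
  have hS1 : S < 1 := by rw [hSdef, div_lt_one hr0]; linarith
  obtain ⟨p, hpdef⟩ : ∃ p : ℝ, p = ψ r := ⟨_, rfl⟩
  obtain ⟨hp0, hp1⟩ := hψb r hr0
  rw [← hpdef] at hp0 hp1
  have hp1' : p ≤ √S / (1 + √S) := by rw [hSdef]; exact hp1
  obtain ⟨hκ0, hκS, hμ0, hμ1, hμid, hκPG⟩ := clockRate_relations hS0 hS1 hp0 hp1'
  obtain ⟨μ, hμdef⟩ : ∃ μ : ℝ, μ = S + p * (1 - S) := ⟨_, rfl⟩
  obtain ⟨κ, hκdef⟩ : ∃ κ : ℝ, κ = S * (1 - p) ^ 2 - p ^ 2 := ⟨_, rfl⟩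
  rw [← hμdef] at hμ0 hμ1 hμid
  rw [← hκdef] at hκ0 hκS hμid hκPG
  obtain ⟨cst, hcstdef⟩ : ∃ cst : ℝ, cst = 1 / √(1 + κ) := ⟨_, rfl⟩
  have hsq : √(1 + κ) ^ 2 = 1 + κ := Real.sq_sqrt (by linarith)
  have hsqpos : 0 < √(1 + κ) := Real.sqrt_pos.mpr (by linarith)
  have hc0 : 0 < cst := by rw [hcstdef]; positivity
  have hc1 : cst ≤ 1 := by
    rw [hcstdef, div_le_one hsqpos]
    nlinarith [Real.sqrt_nonneg (1 + κ)]
  have hc2 : cst ^ 2 * (1 + κ) = 1 := by rw [hcstdef, div_pow, one_pow, hsq]; field_simp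
  obtain ⟨lam, hlamdef⟩ : ∃ lam : ℝ, lam = μ / (1 + κ) := ⟨_, rfl⟩
  have hl0 : 0 ≤ lam := by rw [hlamdef]; exact div_nonneg hμ0 (by linarith)
  have hl1 : lam ≤ 1 := by rw [hlamdef, div_le_one (by linarith)]; linarith
  have hlam : lam * (1 + κ) = μ := by rw [hlamdef, div_mul_cancel₀ _ (by linarith only [hκ0])]
  -- the residue at the centre: `κ/(1+κ) ≤ 1/4` (PG zone: `κ = 0`; beyond `R_a ≥ 8M`: `κ ≤ 2M/r < 1/4`)
  have hκq : κ / (1 + κ) ≤ 1 / 4 := by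
    have hκle : κ / (1 + κ) ≤ κ := div_le_self hκ0 (by linarith only [hκ0])
    refine hκle.trans ?_
    by_cases hra : r ≤ Ra
    · have hp : p = √S / (1 + √S) := by rw [hpdef, hSdef, hψPG r (by linarith only [hqr, hr₂, hr₁]) hra]
      rw [hκPG hp]; norm_num
    · push Not at hra
      have hS4 : S ≤ 1 / 4 := by
        rw [hSdef, div_le_iff₀ hr0]; linarith only [hRa, hra]
      exact hκS.trans hS4
  -- the unit radial vector of the centre
  have hqs : E4.spatial q.1 ≠ 0 := by
    intro h; have : r = 0 := by rw [hrdef, E4.spatialNorm, h, norm_zero]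
    linarith only [this, hr0]
  obtain ⟨n, hndef⟩ : ∃ n : E3, n = r⁻¹ • E4.spatial q.1 := ⟨_, rfl⟩
  have hn : ‖n‖ = 1 := by
    rw [hndef, norm_smul, norm_inv, Real.norm_of_nonneg hr0.le, hrdef, E4.spatialNorm,
      inv_mul_cancel₀ (norm_ne_zero_iff.mpr hqs)]
  have hqn : E4.spatial q.1 = r • n := by
    rw [hndef, smul_smul, mul_inv_cancel₀ hr0.ne', one_smul]
  -- the frame
  obtain ⟨A', hA'⟩ := exists_frameEquiv n cst lam hn hc0.ne'
  obtain ⟨A, hAdef⟩ : ∃ A : E4 →L[ℝ] E4, A = (A' : E4 →L[ℝ] E4) := ⟨_, rfl⟩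
  have hAu : ∀ u : E4, A u = (u 0) • (E4.basisVector 0 : E4) +
      E4.ofTimeSpace 0 (E4.spatial u + ((cst - 1) * ⟪n, E4.spatial u⟫_ℝ - lam * u 0) • n) := fun u ↦ by
    rw [hAdef, ContinuousLinearEquiv.coe_coe]; exact hA' u
  have hA3 : ∀ u, ‖A u‖ ≤ 3 * ‖u‖ := fun u ↦ by rw [hAu]; exact norm_frame_le n cst lam hn hc0 hc1 hl0 hl1 u
  have hA0 : ∀ u, A u 0 = u 0 := fun u ↦ by rw [hAu]; exact (frame_components n cst lam u).1
  have hAsp : ∀ u, E4.spatial (A u) = E4.spatial u + ((cst - 1) * ⟪n, E4.spatial u⟫_ℝ - lam * u 0) • n :=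
    fun u ↦ by rw [hAu]; exact (frame_components n cst lam u).2
  have hAnorm : ‖A‖ ≤ 3 := A.opNorm_le_bound (by norm_num) hA3
  /- (D) the chart -/
  have hmax : max r₁ 0 = r₁ := max_eq_left hr₁.le
  have hr3 : 3 * r₀ < E4.spatialNorm q.1 - max r₁ 0 := by rw [hmax, ← hrdef]; linarith only [hr₀a, hqr, hr₂]
  obtain ⟨Ψ, hΨval, hlate, hcentre, hmf⟩ := isLateChart_ballChart q A A' hAdef.symm hA3 hF hr₀pos hr3
  obtain ⟨θ, hθdef⟩ : ∃ θ : E4 → E4, θ = fun z ↦ q.1 + A z := ⟨_, rfl⟩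
  have hθapp : ∀ z, θ z = q.1 + A z := fun z ↦ by rw [hθdef]
  obtain ⟨Φ, hΦdef⟩ : ∃ Φ : E4 → E4, Φ = fun z ↦ q.1 + A z +
      (F (E4.spatialNorm q.1) - F (E4.spatialNorm (q.1 + A z))) • E4.basisVector 0 := ⟨_, rfl⟩
  have hΦ : ∀ y, Φ y = q.1 + A y + (F (E4.spatialNorm q.1) - F (E4.spatialNorm (q.1 + A y))) • E4.basisVector 0 :=
    fun y ↦ by rw [hΦdef]
  have hmf' : ∀ (y : U) (u : E4), mfderiv 𝓘(ℝ, E4) (𝓡 4) Ψ y u = fderiv ℝ Φ y.1 u := fun y u ↦ by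
    rw [hmf, hΦdef]
  -- on the ball: radius at least `r − 3r₀ ≥ r₁/2`, off the axis
  have hball : ∀ y : U, r₁ / 2 ≤ E4.spatialNorm (q.1 + A y.1) ∧ E4.spatial (q.1 + A y.1) ≠ 0 ∧
      0 < E4.spatialNorm (q.1 + A y.1) ∧ ‖y.1‖ < r₀ := by
    intro y
    have hy : ‖y.1‖ < r₀ := mem_ball_zero_iff.mp y.2
    have hb := (spatialNorm_ballChart_bounds (q := q.1) hA3 y.1).1
    rw [← hrdef] at hb
    have h1 : r₁ / 2 ≤ E4.spatialNorm (q.1 + A y.1) := by linarith only [hb, hy, hr₀a, hqr, hr₂, hr₁, hM']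
    have h2 : 0 < E4.spatialNorm (q.1 + A y.1) := by linarith only [h1, hr₁]
    refine ⟨h1, fun h ↦ ?_, h2, hy⟩
    have : E4.spatialNorm (q.1 + A y.1) = 0 := by rw [E4.spatialNorm, h, norm_zero]
    linarith only [this, h2]
  -- the derivative of the affine part
  have hθf : fderiv ℝ θ = fun _ ↦ A := by
    rw [hθdef]; exact funext fun z ↦ ((A.hasFDerivAt (x := z)).const_add q.1).fderiv
  have hθω : ∀ m : ℕ∞ω, ContDiff ℝ m θ := fun m ↦ by rw [hθdef]; exact contDiff_const.add A.contDiff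
  /- (E) the deviation is `bilinPullback θ G − η` on the ball -/
  have hdev : ∀ (y : U) (u w : E4), (Kerr.spacetime M 0 r₁ hM).deviation (Minkowski.backgroundOn U) Ψ y u w =
      G (q.1 + A y.1) (A u) (A w) - Minkowski.bilin u w := by
    intro y u w
    obtain ⟨hρ1, hρ0, hρpos, -⟩ := hball y
    have hρne : E4.spatialNorm (q.1 + A y.1) ≠ 0 := ne_of_gt hρpos
    rw [Spacetime.deviation_apply]
    erw [hmf', hmf']
    rw [fderiv_ballChart_apply hΦ hρ0 (hFψ _) u, fderiv_ballChart_apply hΦ hρ0 (hFψ _) w]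
    have hpt : (Kerr.spacetime M 0 r₁ hM).metric.val (Ψ y) = Kerr.bilin M 0 (q.1 + A y.1) := by
      change Kerr.bilin M 0 (Ψ y).1 = _
      rw [hΨval y, Kerr.bilin_add_smul_basisVector_zero]
    rw [hpt]
    erw [bilin_clockPullback_apply M (ψ (E4.spatialNorm (q.1 + A y.1))) hρne (A u) (A w),
      hGmid _ hρ1 (A u) (A w)]
    rfl
  have hdevD : ∀ y : U, (Kerr.spacetime M 0 r₁ hM).deviationExtend (Minkowski.backgroundOn U) Ψ y.1 =
      bilinPullback θ G y.1 - Minkowski.bilin := by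
    intro y
    rw [(Kerr.spacetime M 0 r₁ hM).deviationExtend_coe (Minkowski.backgroundOn U) Ψ y]
    ext u w
    rw [hdev y u w, _root_.sub_apply, _root_.sub_apply, bilinPullback_apply, hθf, hθapp]
  have hev : ∀ y : U, (Kerr.spacetime M 0 r₁ hM).deviationExtend (Minkowski.backgroundOn U) Ψ =ᶠ[𝓝 y.1]
      fun z ↦ bilinPullback θ G z - Minkowski.bilin := by
    intro y
    filter_upwards [Metric.isOpen_ball.mem_nhds y.2] with z hz
    exact hdevD ⟨z, hz⟩
  have hBs : ContDiff ℝ ∞ (bilinPullback θ G) := by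
    rw [← contDiffOn_univ]
    exact ContDiffOn.bilinPullback (n := (⊤ : ℕ∞)) (hθω _).contDiffOn hGs.contDiffOn isOpen_univ (mapsTo_univ _ _)
  /- (F) the `C³` bound -/
  have hCk : ∀ m, m ≤ 3 → ∀ z ∈ (U : Set E4), ‖iteratedFDeriv ℝ m
      ((Kerr.spacetime M 0 r₁ hM).deviationExtend (Minkowski.backgroundOn U) Ψ) z‖ ≤ Λr := by
    intro m hm z hz
    rw [((hev ⟨z, hz⟩).iteratedFDeriv ℝ m).eq_of_nhds]
    rw [show (fun z ↦ bilinPullback θ G z - Minkowski.bilin) = bilinPullback θ G - fun _ ↦ Minkowski.bilin from rfl,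
      iteratedFDeriv_sub_apply (contDiff_infty.mp hBs m).contDiffAt contDiffAt_const]
    have h1 : ‖iteratedFDeriv ℝ m (bilinPullback θ G) z‖ ≤ 4 ^ 3 * (3 ! : ℝ) * 3 ^ (3 + 2) * N :=
      norm_iteratedFDeriv_bilinPullback_le (s := univ) (t := univ) isOpen_univ isOpen_univ (k := 3)
        (hθω _).contDiffOn (contDiff_infty.mp hGs 3).contDiffOn
        (mapsTo_univ _ _) (mem_univ z) (Θ := 3) (by norm_num) hN0
        (fun i hi1 _ ↦ by rw [hθdef]; exact (norm_iteratedFDeriv_affine_le q.1 A hi1 z).trans hAnorm)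
        (fun j hj ↦ hNb j hj _) hm
    have h2 : ‖iteratedFDeriv ℝ m (fun _ : E4 ↦ (Minkowski.bilin : E4 →L[ℝ] E4 →L[ℝ] ℝ)) z‖ ≤
        ‖(Minkowski.bilin : E4 →L[ℝ] E4 →L[ℝ] ℝ)‖ := by
      rcases Nat.eq_zero_or_pos m with hm0 | hm0
      · subst hm0; rw [norm_iteratedFDeriv_zero]
      · rw [iteratedFDeriv_const_of_ne (Nat.pos_iff_ne_zero.mp hm0)]; simp
    rw [hΛr]
    exact (norm_sub_le _ _).trans (add_le_add h1 h2)
  /- (G) the `C⁰` bound, pointwise -/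
  have hcentre_id : ∀ u w : E4, G q.1 (A u) (A w) = Minkowski.bilin u w + κ / (1 + κ) * (u 0 * w 0) := by
    intro u w
    have hr1 : r₁ / 2 ≤ E4.spatialNorm q.1 := by rw [← hrdef]; linarith only [hqr, hr₂, hr₁]
    have hsd : ∀ v : E4, sdot q.1 (A v) = r * ⟪n, E4.spatial (A v)⟫_ℝ := fun v ↦ by
      rw [sdot, hqn, inner_smul_left, RCLike.conj_to_real]
    rw [hGmid q.1 hr1 (A u) (A w), hsd, hsd, hA0, hA0, ← hrdef]
    obtain ⟨e1, e2⟩ := centre_coeff_identities M r (ψ r) (u 0) (w 0) ⟪n, E4.spatial (A u)⟫_ℝ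
      ⟪n, E4.spatial (A w)⟫_ℝ hr0.ne'
    rw [e1, e2, hAsp u, hAsp w]
    have key := frame_pullback n cst lam hn (S := S) hκ0 hc2 hlam hμid u w
    rw [← hAu u, ← hAu w] at key
    rw [← hpdef, ← hSdef, ← hμdef, ← hκdef]
    exact key
  have hθ0 : θ 0 = q.1 := by rw [hθapp, map_zero, add_zero]
  have hC0pt : ∀ y : U, ‖bilinPullback θ G y.1 - Minkowski.bilin‖ ≤ 1 / 2 := by
    intro y
    obtain ⟨-, -, -, hy⟩ := hball y
    have hsplit : bilinPullback θ G y.1 - Minkowski.bilin =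
        (bilinPullback θ G y.1 - bilinPullback θ G 0) + (bilinPullback θ G 0 - Minkowski.bilin) :=
      (sub_add_sub_cancel _ _ _).symm
    have hpart1 : ‖bilinPullback θ G y.1 - bilinPullback θ G 0‖ ≤ 1 / 4 := by
      -- variation over the ball
      have hb : ‖bilinPullback θ G y.1 - bilinPullback θ G 0‖ ≤ 9 * (|C₁| * (3 * r₀)) := by
        refine ContinuousLinearMap.opNorm_le_bound₂ _ (by positivity) fun u w ↦ ?_
        rw [_root_.sub_apply, _root_.sub_apply, bilinPullback_apply, bilinPullback_apply,
          hθf, hθ0, hθapp]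
        change ‖(G (q.1 + A y.1) - G q.1) (A u) (A w)‖ ≤ _
        have h1 := (G (q.1 + A y.1) - G q.1).le_opNorm₂ (A u) (A w)
        have h2 : ‖G (q.1 + A y.1) - G q.1‖ ≤ |C₁| * (3 * r₀) := by
          refine (hGlip q.1 (q.1 + A y.1)).trans ?_
          have : ‖q.1 + A y.1 - q.1‖ ≤ 3 * r₀ := by
            rw [add_sub_cancel_left]
            exact (hA3 y.1).trans (by linarith only [hy])
          exact mul_le_mul_of_nonneg_left this (abs_nonneg _)
        have h3 := hA3 u
        have h4 := hA3 w
        calc ‖(G (q.1 + A y.1) - G q.1) (A u) (A w)‖ ≤ ‖G (q.1 + A y.1) - G q.1‖ * ‖A u‖ * ‖A w‖ := h1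
          _ ≤ (|C₁| * (3 * r₀)) * (3 * ‖u‖) * (3 * ‖w‖) := by gcongr
          _ = 9 * (|C₁| * (3 * r₀)) * ‖u‖ * ‖w‖ := by ring
      linarith only [hb, hr₀b]
    have hpart2 : ‖bilinPullback θ G 0 - Minkowski.bilin‖ ≤ 1 / 4 := by
      -- the centre: the exact pull-back identity
      have hc : bilinPullback θ G 0 - Minkowski.bilin = (κ / (1 + κ)) • E4.tmul (E4.dx 0) (E4.dx 0) := by
        ext u w
        rw [_root_.sub_apply, _root_.sub_apply, bilinPullback_apply, hθf, hθ0, hcentre_id u w]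
        simp only [FunLike.coe_smul, Pi.smul_apply, smul_eq_mul, E4.tmul_apply]
        show _ = κ / (1 + κ) * (u 0 * w 0)
        ring
      have hk0' : 0 ≤ κ / (1 + κ) := div_nonneg hκ0 (by linarith only [hκ0])
      rw [hc, norm_smul, Real.norm_of_nonneg hk0']
      calc κ / (1 + κ) * ‖(E4.tmul (E4.dx 0) (E4.dx 0) : E4 →L[ℝ] E4 →L[ℝ] ℝ)‖ ≤ 1 / 4 * 1 :=
            mul_le_mul hκq norm_tmul_dx_zero_le (norm_nonneg _) (by norm_num)
        _ = 1 / 4 := by norm_num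
    rw [hsplit]
    exact (norm_add_le _ _).trans ((add_le_add hpart1 hpart2).trans_eq (by norm_num))
  refine ⟨Ψ, hlate, hcentre, supCkENorm_le_ofReal hCk, ?_, fun x ↦ ?_, fun x ↦ ?_⟩
  · -- the `C⁰` clause
    refine (supCkENorm_le_ofReal (C := 1 / 2) fun m hm z hz ↦ ?_).trans (le_of_eq ?_)
    · obtain rfl : m = 0 := Nat.le_zero.mp hm
      rw [norm_iteratedFDeriv_zero, hdevD ⟨z, hz⟩]
      exact hC0pt ⟨z, hz⟩
    · rw [ENNReal.ofReal_div_of_pos two_pos, ENNReal.ofReal_one, ENNReal.ofReal_ofNat]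
  · -- `Ψ_* ∂₀` is future-directed causal
    obtain ⟨hρ1, hρ0, hρpos, hy⟩ := hball x
    have hρne : E4.spatialNorm (q.1 + A x.1) ≠ 0 := ne_of_gt hρpos
    obtain ⟨v, hvdef⟩ : ∃ v : E4, v = mfderiv 𝓘(ℝ, E4) (𝓡 4) Ψ x (E4.basisVector 0) := ⟨_, rfl⟩
    have hv : v = A (E4.basisVector 0) - (ψ (E4.spatialNorm (q.1 + A x.1)) *
        (sdot (q.1 + A x.1) (A (E4.basisVector 0)) / E4.spatialNorm (q.1 + A x.1))) • E4.basisVector 0 := by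
      rw [hvdef, hmf', fderiv_ballChart_apply hΦ hρ0 (hFψ _)]
    -- its time component is positive
    have hv0 : 0 < v 0 := by
      have hsp0 : E4.spatial (A (E4.basisVector 0)) = (-lam) • n := by
        rw [hAsp]
        have : E4.spatial (E4.basisVector 0) = 0 := by ext i; simp
        simp [this]
      have hsd : |sdot (q.1 + A x.1) (A (E4.basisVector 0))| ≤ E4.spatialNorm (q.1 + A x.1) * lam := by
        rw [sdot, hsp0, inner_smul_right]
        have := abs_real_inner_le_norm (E4.spatial (q.1 + A x.1)) n
        rw [hn, mul_one] at this
        rw [abs_mul, abs_neg, abs_of_nonneg hl0, E4.spatialNorm]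
        nlinarith only [this, hl0, abs_nonneg ⟪E4.spatial (q.1 + A x.1), n⟫_ℝ]
      obtain ⟨hψ1, hψ2⟩ := hψb _ hρpos
      have hψlt : ψ (E4.spatialNorm (q.1 + A x.1)) < 1 := hψ2.trans_lt (fPG_nonneg_lt_one M _).2
      have hquot : |ψ (E4.spatialNorm (q.1 + A x.1)) *
          (sdot (q.1 + A x.1) (A (E4.basisVector 0)) / E4.spatialNorm (q.1 + A x.1))| < 1 := by
        rw [abs_mul, abs_div, abs_of_nonneg hψ1, abs_of_pos hρpos]
        have h1 : |sdot (q.1 + A x.1) (A (E4.basisVector 0))| / E4.spatialNorm (q.1 + A x.1) ≤ lam := by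
          rw [div_le_iff₀ hρpos]; linarith only [hsd]
        calc _ ≤ ψ (E4.spatialNorm (q.1 + A x.1)) * lam := by gcongr
          _ < 1 * 1 := by nlinarith only [hψlt, hl1, hψ1, hl0]
          _ = 1 := one_mul 1
      rw [hv]
      simp only [PiLp.sub_apply, PiLp.smul_apply, smul_eq_mul, hA0]
      have h00 : (E4.basisVector 0 : E4) 0 = 1 := by simp
      rw [h00, mul_one]
      linarith only [(abs_lt.mp hquot).2]
    have hvne : v ≠ 0 := fun h ↦ by rw [h] at hv0; simp at hv0
    -- its length² is `deviation(∂₀, ∂₀) − 1 ≤ 1/2 − 1 < 0`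
    have hlen : (Kerr.spacetime M 0 r₁ hM).metric.val (Ψ x) v v ≤ 0 := by
      have hd := (Kerr.spacetime M 0 r₁ hM).deviation_apply (Minkowski.backgroundOn U) Ψ x (E4.basisVector 0)
        (E4.basisVector 0)
      have hD : ‖(Kerr.spacetime M 0 r₁ hM).deviation (Minkowski.backgroundOn U) Ψ x‖ ≤ 1 / 2 := by
        rw [← (Kerr.spacetime M 0 r₁ hM).deviationExtend_coe, hdevD x]; exact hC0pt x
      have habs := ((Kerr.spacetime M 0 r₁ hM).deviation (Minkowski.backgroundOn U) Ψ x).le_opNorm₂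
        (E4.basisVector 0) (E4.basisVector 0)
      rw [BentLabDeviation.norm_basisVector_zero, mul_one, mul_one, Real.norm_eq_abs] at habs
      have hη : (Minkowski.backgroundOn U).bilin x.1 (E4.basisVector 0) (E4.basisVector 0) = -1 :=
        Minkowski.bilin_basisVector_zero
      rw [hη] at hd
      erw [← hvdef] at hd
      linarith only [hd, (abs_le.mp (habs.trans hD)).2]
    rw [← hvdef]
    refine ⟨⟨hlen, hvne⟩, ?_⟩
    change Kerr.bilin M 0 (Ψ x).1 (Kerr.timeVector M 0 (Ψ x).1) v < 0
    rw [Kerr.bilin_timeVector (Kerr.radius_pos_of_mem_region (Ψ x).2)]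
    linarith only [hv0]
  · -- the clock
    rw [hclock, hclock, Kerr.radius_zero_left, Kerr.radius_zero_left, hΨval x, ← hΦ x.1,
      clock_ballChart hΦ hA0 x.1, ← hrdef]

/-- **Summary (registered form): the `tame` clause of `IsTameEnd` for the Schwarzschild end with the
Painlevé–Gullstrand-corrected clock** — `Schw.exists_tame_balls` with all hypotheses as arrows. [cite: Anderson2004, Def. 1.1] -/
theorem schwarzschild_tame_balls : ∀ (E : EndDatum (Kerr.spacetime M 0 r₁ hM)), 0 < M → 0 < r₁ → r₁ < 2 * M → ∀ {F ψ : ℝ → ℝ}, ContDiff ℝ ∞ F → ContDiff ℝ ∞ ψ → (∀ r, HasDerivAt F (ψ r) r) → ∀ {Ra Rb : ℝ}, 8 * M ≤ Ra → Ra < Rb → (∀ r, r₁ / 2 ≤ r → r ≤ Ra → ψ r = √(2 * M / r) / (1 + √(2 * M / r))) → (∀ r, Rb ≤ r → ψ r = 0) → (∀ r, 0 < r → 0 ≤ ψ r ∧ ψ r ≤ √(2 * M / r) / (1 + √(2 * M / r))) → (∀ x, E.clock x = x.1 0 + F (Kerr.radius 0 x.1)) → E.doc = {x | 2 * M < Kerr.radius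 0 x.1} → ∃ (Λ : ℝ≥0) (r₀ : ℝ), 0 < r₀ ∧ ∀ q ∈ E.doc, let U : Opens E4 := ⟨Metric.ball (0 : E4) r₀, Metric.isOpen_ball⟩; ∃ Ψ : U → (Kerr.spacetime M 0 r₁ hM).carrier, (Kerr.spacetime M 0 r₁ hM).IsLateChart (Minkowski.backgroundOn U) Set.univ (-r₀) Ψ ∧ (∃ x : U, (x : E4) = 0 ∧ Ψ x = q) ∧ supCkENorm (U : Set E4) 3 ((Kerr.spacetime M 0 r₁ hM).deviationExtend (Minkowski.backgroundOn U) Ψ) ≤ (Λ : ℝ≥0∞) ∧ supCkENorm (U : Set E4) 0 ((Kerr.spacetime M 0 r₁ hM).deviationExtend (Minkowski.backgroundOn U) Ψ) ≤ 1 / 2 ∧ (∀ x : U, (Kerr.spacetime M 0 r₁ hM).timeOrientation.IsFutureDirected (mfderiv 𝓘(ℝ, E4) (𝓡 4) Ψ x (E4.basisVector 0))) ∧ ∀ x : U, E.clock (Ψ x) = (x : E4) 0 + E.clock q :=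
  fun E hM' hr₁ hr₂ _ _ hF hψ hFψ _ _ hRa hab hψPG hψ0 hψb hclock hdoc ↦
    exists_tame_balls E hM' hr₁ hr₂ hF hψ hFψ hRa hab hψPG hψ0 hψb hclock hdoc

end Patch

end Summit.FinalStateConjecture.FinalStateConjecture.Theorems.TameHull.Schw

end
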